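import Summits.AnomalousDissipation.AnomalousDissipation.Theorems.SolenoidalFractalHomogenisationLagrangianStepVmodFrameDefsJ
import Summits.AnomalousDissipation.AnomalousDissipation.Theorems.SolenoidalFractalHomogenisationLagrangianStepCellEnergyTDualDefs
import HarnessLib

/-!
# K1L_D (stmt-AnomalousDissipation-27980), (ℓ3-A) road A: the ENERGY-IDENTITY clause `EnergyIdG` for a distorted propagator — the bytes of the
# local binder `hEnergy` (tenure RULING D28-21′ (1): «instance-first + local binder», the `hsol` precedent)
(Summits-side definitions file of route `SolenoidalFractalHomogenisation`; review lane; prover ad-k1loc-p3 g11.)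

CONVENTION (D28-8′): derivative-index distortion `Torus.Visc4.conj`; constraint `∇·(G v) = 0`.

`VmodDist.EnergyIdG Tw 𝔸 b G U` is the G-TWIN of the landed flat propagator energy EQUALITY `Torus.IsPropagator.exists_norm_sq_eq`
(`Literature/…/PassiveVectorTensorPropagatorEnergyEquality.lean`), stated as a PREDICATE on a distorted propagator (to be taken by the (ℓ3)-internal
row texts / block proofs as the LOCAL hypothesis `hEnergy : EnergyIdG Tw 𝔸' b G U`, spelled by this ONE name; discharged at the head by the instance
via ad-lit's (E1-T) transfer — pullback `‖w t‖ = ‖u t‖` + the flat energy equality —; folded later into `IsDistortedPropagatorE := IsDistortedPropagatorS ∧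
EnergyIdG`, D28-21′ (3)): from every base time `0 ≤ s < Tw` and every `G(s)`-solenoidal datum `y ∈ V2` there are a distorted weak solution `w` on
`(0, Tw − s)` along `τ ↦ b (s+τ)`, `τ ↦ G (s+τ)` from `y` and its weak space gradient `Dw ∈ L²(μ_{Tw−s})` (a.e. slice weak partial derivatives)
such that for EVERY `t ∈ [s, Tw)`
  `‖U s t y‖² = ‖y‖² − 2 ∫_{(0,t−s]} ∫ Σ_{l,i,c,e} (𝔸^{G(s+τ,x)})_{icle} (Dw τ c x)_i (Dw τ e x)_l dx dτ`,
`𝔸^{G} = Torus.Visc4.conj G 𝔸` — i.e. `lossFwd (U s t) y = 2∫ D_{G}(w)`, the identity written with the LOSS as the primitive object and the dissipation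
through the weak gradient (no `∇` of an `L²` class; the integrand is integrable by the `MemLp` clause).  The ADJOINT twin for `lossAdj` is the same
clause for the adjoint member (time-reversed carrier and frame, majorly transposed tensor): typed in Amendment 1 below as `EnergyIdGAdj` (lead g7 (O3) bytes).
* `EnergyIdG`; `energyIdG_iff` (unfolding); degenerate reading `G ≡ 1`: the integrand is the flat one (`Visc4.conj_one`), see the docstring of
  `energyIdG_one_integrand`.
Definitions + trivial lemmas only; NOT a proof of any block, of K1L_D or of AD; rung F-D1.A0.
-/

set_option linter.dupNamespace false

noncomputable section

namespace Summit.AnomalousDissipation.AnomalousDissipation.Theorems.SolenoidalFractalHomogenisation.LagrangianStep.VmodDist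

open Literature.Analysis Literature.Analysis.FluidPDE Literature.Analysis.FunctionSpaces
open MeasureTheory Set Filter UnitAddTorus Function
open scoped ENNReal NNReal InnerProductSpace
open Summit.AnomalousDissipation.AnomalousDissipation.Theorems.SolenoidalFractalHomogenisation.LagrangianStep.CellClauseMod

/-- **`EnergyIdG Tw 𝔸 b G U` — the energy EQUALITY of a distorted propagator, G-twin of `Torus.IsPropagator.exists_norm_sq_eq`** (bytes of the
local binder `hEnergy`, RULING D28-21′ (1)).  [cite: LionsMagenes1972, Chap. 3 §4.4 (4.20)] [cite: Temam1984, Ch. III §1 Thm. 1.1] -/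
def EnergyIdG (Tw : ℝ) (𝔸 : Torus.Visc4 (Fin 3)) (b : ℝ → VF) (G : ℝ → UnitAddTorus (Fin 3) → Matrix (Fin 3) (Fin 3) ℝ)
    (U : ℝ → ℝ → (V2 →L[ℝ] V2)) : Prop :=
  ∀ s : ℝ, 0 ≤ s → s < Tw → ∀ y : V2, Torus.IsWeaklyDivFree (Torus.distort (G s) ((y : V2) : VF)) →
    ∃ (w : ℝ → VF) (Dw : ℝ → Fin 3 → VF),
      Torus.IsWeakTensorPassiveVectorDistortedOn 0 (Tw - s) 𝔸 (fun τ => b (s + τ)) (fun τ => G (s + τ)) ((y : V2) : VF) w ∧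
      (∀ c, MemLp (uncurry (Dw · c)) 2 (((volume : Measure ℝ).restrict (Ioo 0 (Tw - s))).prod volume)) ∧
      (∀ᵐ τ ∂(volume.restrict (Ioo 0 (Tw - s))), ∀ c, Torus.HasWeakPartialDeriv c (w τ) (Dw τ c)) ∧
      ∀ t ∈ Ico s Tw, ‖U s t y‖ ^ 2 = ‖y‖ ^ 2 -
        2 * ∫ τ in Ioc 0 (t - s), ∫ x, ∑ l, ∑ i, ∑ c, ∑ e, Torus.Visc4.conj (G (s + τ) x) 𝔸 i c l e * (Dw τ c x) i * (Dw τ e x) l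

/-- Unfolding. -/
theorem energyIdG_iff {Tw : ℝ} {𝔸 : Torus.Visc4 (Fin 3)} {b : ℝ → VF} {G : ℝ → UnitAddTorus (Fin 3) → Matrix (Fin 3) (Fin 3) ℝ}
    {U : ℝ → ℝ → (V2 →L[ℝ] V2)} :
    EnergyIdG Tw 𝔸 b G U ↔
      ∀ s : ℝ, 0 ≤ s → s < Tw → ∀ y : V2, Torus.IsWeaklyDivFree (Torus.distort (G s) ((y : V2) : VF)) →
        ∃ (w : ℝ → VF) (Dw : ℝ → Fin 3 → VF),
          Torus.IsWeakTensorPassiveVectorDistortedOn 0 (Tw - s) 𝔸 (fun τ => b (s + τ)) (fun τ => G (s + τ)) ((y : V2) : VF) w ∧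
          (∀ c, MemLp (uncurry (Dw · c)) 2 (((volume : Measure ℝ).restrict (Ioo 0 (Tw - s))).prod volume)) ∧
          (∀ᵐ τ ∂(volume.restrict (Ioo 0 (Tw - s))), ∀ c, Torus.HasWeakPartialDeriv c (w τ) (Dw τ c)) ∧
          ∀ t ∈ Ico s Tw, ‖U s t y‖ ^ 2 = ‖y‖ ^ 2 -
            2 * ∫ τ in Ioc 0 (t - s), ∫ x, ∑ l, ∑ i, ∑ c, ∑ e, Torus.Visc4.conj (G (s + τ) x) 𝔸 i c l e * (Dw τ c x) i * (Dw τ e x) l :=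
  Iff.rfl

/-- Degenerate reading (certifier probe): for the identity frame the integrand is the FLAT one, `𝔸^{1} = 𝔸`. -/
theorem energyIdG_one_integrand (𝔸 : Torus.Visc4 (Fin 3)) (i c l e : Fin 3) :
    Torus.Visc4.conj (1 : Matrix (Fin 3) (Fin 3) ℝ) 𝔸 i c l e = 𝔸 i c l e := by
  rw [Torus.Visc4.conj_one]

/-- The identity yields the LOSS of the window map: `lossFwd (U s t) y = 2∫∫ Σ 𝔸^{G}…` (the form the block proofs consume). -/
theorem EnergyIdG.lossFwd_eq {Tw : ℝ} {𝔸 : Torus.Visc4 (Fin 3)} {b : ℝ → VF} {G : ℝ → UnitAddTorus (Fin 3) → Matrix (Fin 3) (Fin 3) ℝ}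
    {U : ℝ → ℝ → (V2 →L[ℝ] V2)} (h : EnergyIdG Tw 𝔸 b G U) {s : ℝ} (hs : 0 ≤ s) (hsT : s < Tw) (y : V2)
    (hy : Torus.IsWeaklyDivFree (Torus.distort (G s) ((y : V2) : VF))) :
    ∃ (w : ℝ → VF) (Dw : ℝ → Fin 3 → VF),
      Torus.IsWeakTensorPassiveVectorDistortedOn 0 (Tw - s) 𝔸 (fun τ => b (s + τ)) (fun τ => G (s + τ)) ((y : V2) : VF) w ∧
      (∀ᵐ τ ∂(volume.restrict (Ioo 0 (Tw - s))), ∀ c, Torus.HasWeakPartialDeriv c (w τ) (Dw τ c)) ∧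
      ∀ t ∈ Ico s Tw, lossFwd (U s t) y =
        2 * ∫ τ in Ioc 0 (t - s), ∫ x, ∑ l, ∑ i, ∑ c, ∑ e, Torus.Visc4.conj (G (s + τ) x) 𝔸 i c l e * (Dw τ c x) i * (Dw τ e x) l := by
  obtain ⟨w, Dw, hw, _, hD, hE⟩ := h s hs hsT y hy
  refine ⟨w, Dw, hw, hD, fun t ht => ?_⟩
  unfold lossFwd
  rw [hE t ht]; ring

/-! ## Amendment 1 (append-only; lead g7 14:55:22Z (O3), D28-22 (5)): the ADJOINT twin `EnergyIdGAdj` — `EnergyIdG` read backward from the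
window end `t₀` with the flat dual conventions of `…CellEnergyTDualDefs` (tensor `Torus.majorTranspose 𝔸`, drift `revCarrier b t₀ = (r,x) ↦ −b(t₀−r,x)`,
reversed frame `σ ↦ G (t₀ − σ)`), the identity stated for `(U s t₀)†ζ` directly; consumed as `lossAdj (U s t₀) ζ = 2∫_{(0,t₀−s]}∫ Σ …`. -/

open Summit.AnomalousDissipation.AnomalousDissipation.Theorems.SolenoidalFractalHomogenisation.LagrangianStep.CellEnergyT

/-- **`EnergyIdGAdj Tw 𝔸 b G U` — the ADJOINT energy equality of a distorted propagator** (bytes of the local binder `hEnergyAdj`; lead g7 (O3)):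
from every window end `0 < t₀ ≤ Tw` and every `G(t₀)`-solenoidal `ζ ∈ V2` there are a distorted weak solution `ψ` on `(0,t₀)` of the BACKWARD problem
(tensor `majorTranspose 𝔸`, carrier `revCarrier b t₀`, frame `σ ↦ G (t₀ − σ)`) from `ζ` and its weak gradient `Dψ ∈ L²` such that for every `s ∈ [0,t₀)`
`‖(U s t₀)† ζ‖² = ‖ζ‖² − 2∫_{(0,t₀−s]}∫ Σ (majorTranspose 𝔸)^{G(t₀−σ,x)} Dψ Dψ`.  [cite: LionsMagenes1972, Chap. 3 §4.4 (4.20)] [cite: Temam1984, Ch. III §1 Thm. 1.1] -/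
def EnergyIdGAdj (Tw : ℝ) (𝔸 : Torus.Visc4 (Fin 3)) (b : ℝ → VF) (G : ℝ → UnitAddTorus (Fin 3) → Matrix (Fin 3) (Fin 3) ℝ)
    (U : ℝ → ℝ → (V2 →L[ℝ] V2)) : Prop :=
  ∀ t₀ : ℝ, 0 < t₀ → t₀ ≤ Tw → ∀ ζ : V2, Torus.IsWeaklyDivFree (Torus.distort (G t₀) ((ζ : V2) : VF)) →
    ∃ (ψ : ℝ → VF) (Dψ : ℝ → Fin 3 → VF),
      Torus.IsWeakTensorPassiveVectorDistortedOn 0 t₀ (Torus.majorTranspose 𝔸) (revCarrier b t₀) (fun σ => G (t₀ - σ)) ((ζ : V2) : VF) ψ ∧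
      (∀ c, MemLp (uncurry (Dψ · c)) 2 (((volume : Measure ℝ).restrict (Ioo 0 t₀)).prod volume)) ∧
      (∀ᵐ σ ∂(volume.restrict (Ioo 0 t₀)), ∀ c, Torus.HasWeakPartialDeriv c (ψ σ) (Dψ σ c)) ∧
      ∀ s ∈ Ico 0 t₀, ‖ContinuousLinearMap.adjoint (U s t₀) ζ‖ ^ 2 = ‖ζ‖ ^ 2 -
        2 * ∫ σ in Ioc 0 (t₀ - s), ∫ x, ∑ l, ∑ i, ∑ c, ∑ e,
          Torus.Visc4.conj (G (t₀ - σ) x) (Torus.majorTranspose 𝔸) i c l e * (Dψ σ c x) i * (Dψ σ e x) l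

/-- Unfolding. -/
theorem energyIdGAdj_iff {Tw : ℝ} {𝔸 : Torus.Visc4 (Fin 3)} {b : ℝ → VF} {G : ℝ → UnitAddTorus (Fin 3) → Matrix (Fin 3) (Fin 3) ℝ}
    {U : ℝ → ℝ → (V2 →L[ℝ] V2)} :
    EnergyIdGAdj Tw 𝔸 b G U ↔
      ∀ t₀ : ℝ, 0 < t₀ → t₀ ≤ Tw → ∀ ζ : V2, Torus.IsWeaklyDivFree (Torus.distort (G t₀) ((ζ : V2) : VF)) →
        ∃ (ψ : ℝ → VF) (Dψ : ℝ → Fin 3 → VF),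
          Torus.IsWeakTensorPassiveVectorDistortedOn 0 t₀ (Torus.majorTranspose 𝔸) (revCarrier b t₀) (fun σ => G (t₀ - σ)) ((ζ : V2) : VF) ψ ∧
          (∀ c, MemLp (uncurry (Dψ · c)) 2 (((volume : Measure ℝ).restrict (Ioo 0 t₀)).prod volume)) ∧
          (∀ᵐ σ ∂(volume.restrict (Ioo 0 t₀)), ∀ c, Torus.HasWeakPartialDeriv c (ψ σ) (Dψ σ c)) ∧
          ∀ s ∈ Ico 0 t₀, ‖ContinuousLinearMap.adjoint (U s t₀) ζ‖ ^ 2 = ‖ζ‖ ^ 2 -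
            2 * ∫ σ in Ioc 0 (t₀ - s), ∫ x, ∑ l, ∑ i, ∑ c, ∑ e,
              Torus.Visc4.conj (G (t₀ - σ) x) (Torus.majorTranspose 𝔸) i c l e * (Dψ σ c x) i * (Dψ σ e x) l :=
  Iff.rfl

/-- The reversed carrier is the flat dual one: `revCarrier b t₀ r x = −b (t₀ − r) x` (certifier probe). -/
theorem energyIdGAdj_revCarrier_apply (b : ℝ → VF) (t₀ r : ℝ) (x : UnitAddTorus (Fin 3)) : revCarrier b t₀ r x = -(b (t₀ - r) x) := rfl

/-- The adjoint identity yields the ADJOINT LOSS of the window map: `lossAdj (U s t₀) ζ = 2∫∫ Σ (majorTranspose 𝔸)^{G}…` (mirror of `EnergyIdG.lossFwd_eq`). -/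
theorem EnergyIdGAdj.lossAdj_eq {Tw : ℝ} {𝔸 : Torus.Visc4 (Fin 3)} {b : ℝ → VF} {G : ℝ → UnitAddTorus (Fin 3) → Matrix (Fin 3) (Fin 3) ℝ}
    {U : ℝ → ℝ → (V2 →L[ℝ] V2)} (h : EnergyIdGAdj Tw 𝔸 b G U) {t₀ : ℝ} (ht₀ : 0 < t₀) (ht₀T : t₀ ≤ Tw) (ζ : V2)
    (hζ : Torus.IsWeaklyDivFree (Torus.distort (G t₀) ((ζ : V2) : VF))) :
    ∃ (ψ : ℝ → VF) (Dψ : ℝ → Fin 3 → VF),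
      Torus.IsWeakTensorPassiveVectorDistortedOn 0 t₀ (Torus.majorTranspose 𝔸) (revCarrier b t₀) (fun σ => G (t₀ - σ)) ((ζ : V2) : VF) ψ ∧
      (∀ᵐ σ ∂(volume.restrict (Ioo 0 t₀)), ∀ c, Torus.HasWeakPartialDeriv c (ψ σ) (Dψ σ c)) ∧
      ∀ s ∈ Ico 0 t₀, lossAdj (U s t₀) ζ =
        2 * ∫ σ in Ioc 0 (t₀ - s), ∫ x, ∑ l, ∑ i, ∑ c, ∑ e,
          Torus.Visc4.conj (G (t₀ - σ) x) (Torus.majorTranspose 𝔸) i c l e * (Dψ σ c x) i * (Dψ σ e x) l := by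
  obtain ⟨ψ, Dψ, hψ, _, hD, hE⟩ := h t₀ ht₀ ht₀T ζ hζ
  refine ⟨ψ, Dψ, hψ, hD, fun s hs => ?_⟩
  unfold lossAdj
  rw [hE s hs]; ring

end Summit.AnomalousDissipation.AnomalousDissipation.Theorems.SolenoidalFractalHomogenisation.LagrangianStep.VmodDist

end
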